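import Summits.QuantumFields.YangMills.Theorems.MirrorModularBoostsCurvatureBoostCovarianceDominatedTieLimit

/-!
# `TemperedCurvatureMoments`, line `Sketch`: `⁰𝒮` lies in the closed span of the SEPARATED compactly supported real product tensors

Stub `stub_sepDensity` (A1) of the line `Sketch` (markov-shielding) of crux `stmt-QuantumFields-17721`
(`Summit.QuantumFields.YangMills.Theses.IsotropyFromPowerCounting.TemperedCurvatureMoments`), proved
over the tree as it is (no definition, no named fact).

Write `X = (ℝ⁴)ⁿ = Fin n → E4`, `A ⊆ X` for the coincidence locus (`coincidenceLocus`, some `xᵢ = xⱼ`,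
`i ≠ j`) and `⁰𝒮 ⊆ 𝓢(X, ℂ)` for the Schwartz functions flat on `A` (`IsOffDiagonal`).  The SEPARATED
class `𝒯` consists of the real product tensors `P = f₁ ⊗ ⋯ ⊗ fₙ` (`IsTensorOf P (ofRealTest ∘ f)`,
`fᵢ ∈ 𝓢(ℝ⁴, ℝ)`) whose factors are compactly supported, `tsupport fᵢ ⊆ B̄(0, R)`, with pairwise
separated supports: `r ≤ ‖y - z‖` for `y ∈ tsupport fᵢ`, `z ∈ tsupport fⱼ`, `i ≠ j`, for some `r > 0`.

**Statement.** `⁰𝒮 ⊆ closure (span_ℂ 𝒯)`.  This sharpens the landed `offDiagDensity` /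
`localOffDiagDensity` (crux `NPointIsotropy`), whose dense class is all off-diagonal real product
tensors.

**Proof.**
1. *Reduction to compact support off the diagonals* (as in `offDiagDensity`): for `F ∈ ⁰𝒮` the
   cut-off family `ψ_k` of `offDiagCutoffFamily` gives `u_k = ψ_k F → F` in `𝓢`
   (`offDiagCutoffTendsto`), `u_k` vanishing near `A`; the closed span being closed it suffices that
   each `u_k` lies in it, and by `mem_of_isClosed_of_cutoffs` it suffices to treat compactly supported
   `G` with `tsupport G ⊆ tsupport u_k ⊆ Aᶜ` (`tsupport_cutoff_mul_subset_compl_coincidenceLocus`).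
2. *Local part* (a variant of `localOffDiagDensity` at half the mesh): `exists_mesh` gives `h₀ > 0`
   with `12 h₀ < ‖vᵢ - vⱼ‖` on `tsupport G` (`i ≠ j`); put `h = h₀ / 2`, so `24 h < ‖vᵢ - vⱼ‖`.  The
   lattice partition of unity at mesh `h` (`meshCoord`, `latticeBump`, `tendsto_latticeWindow_smul`,
   `sum_latticeCube_latticeBump`) writes `W_R · G = ∑_β η_β · G → G`, and the closure of a submodule is
   a submodule, so it suffices that every piece `η_β · G` lies in the closed span.
3. *One piece* (`SepDensity.smulLeftCLM_latticeBump_mem_closure`): `η_β · G` is supported in the closed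
   box `∏ [(β_{ic} - 1) h, (β_{ic} + 1) h]`, which contains a point `v ∈ tsupport G` unless the piece
   vanishes; the box engine `mem_closure_span_boxTensors` with outer box
   `∏ ((β_{ic} - 2) h, (β_{ic} + 2) h)` puts the piece in the closed span of the real product tensors
   whose factors `g_k` are supported in the outer blocks.  These blocks are bounded
   (`|x_c| ≤ (∑ |β| ) h + 2 h`, so `tsupport g_k ⊆ B̄(0, R)` by `EuclideanSpace.norm_le_sqrt_card_mul`)
   and PAIRWISE `6h`-SEPARATED: if `y ∈ tsupport gᵢ`, `z ∈ tsupport gⱼ`, `i ≠ j`, had `‖y - z‖ < 6 h`,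
   then `|yᶜ - vᵢᶜ| < 3 h`, `|zᶜ - vⱼᶜ| < 3 h` and `|yᶜ - zᶜ| < 6 h` would give `|vᵢᶜ - vⱼᶜ| ≤ 12 h`
   for every coordinate `c`, i.e. `‖vᵢ - vⱼ‖ ≤ 2 · 12 h = 24 h`, contradicting step 2.

References: K. Osterwalder, R. Schrader, Comm. Math. Phys. 31 (1973) §2 (`⁰𝒮`); L. Hörmander, The
Analysis of Linear Partial Differential Operators I, Lemma 7.1.8 (cut-offs off a closed set in the flat
functions); the Fourier-series proof of the density of `C_c^∞(X) ⊗ C_c^∞(Y)` in `C_c^∞(X × Y)`.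
[folklore]
-/

noncomputable section

namespace Summit.QuantumFields.YangMills.Theorems.TemperedCurvatureMoments.Sketch

open scoped BigOperators SchwartzMap Topology
open MeasureTheory Filter Set
open Literature.MathematicalPhysics.QuantumLattice Literature.MathematicalPhysics.AQFT
open Summit.QuantumFields.YangMills.Theorems.NPointIsotropy.Negative (E4)
open Summit.QuantumFields.YangMills.Theorems.NPointIsotropy.ComplexRotationBandlimit

namespace SepDensity

/-- **One piece of the lattice partition lies in the closed span of the separated tensors.** For
`G ∈ 𝓢((ℝ⁴)ⁿ, ℂ)` whose support has components separated by more than `24 h`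
(`24 h < ‖vᵢ - vⱼ‖` on `tsupport G`, `i ≠ j`) and `β ∈ ℤ^{4n}`, the piece `η_β · G` (`η_β` the
lattice bump of `SchwartzPartition` in the mesh coordinates at scale `h`) belongs to the closure of
the span of the separated compactly supported real product tensors: it is supported in the closed
box `∏ [(β_{ic} - 1) h, (β_{ic} + 1) h]`, which contains a point `v ∈ tsupport G` unless the piece
vanishes; the box engine `mem_closure_span_boxTensors` with outer box
`∏ ((β_{ic} - 2) h, (β_{ic} + 2) h)` applies, and a real product tensor with factors supported in the
outer blocks has factors supported in `B̄(0, 2((∑|β|) h + 2 h))` and pairwise `6 h`-separated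
(`‖y - z‖ < 6 h` for `y`, `z` in the blocks `i ≠ j` would give `|vᵢᶜ - vⱼᶜ| ≤ 12 h` for all `c`,
so `‖vᵢ - vⱼ‖ ≤ 24 h`). [folklore] -/
theorem smulLeftCLM_latticeBump_mem_closure {n : ℕ} (G : 𝓢((Fin n → E4), ℂ)) {h : ℝ}
    (hh : 0 < h)
    (hsep : ∀ v ∈ tsupport (G : (Fin n → E4) → ℂ), ∀ i j : Fin n, i ≠ j → 24 * h < ‖v i - v j‖)
    (β : Fin (n * 4) → ℤ) :
    SchwartzMap.smulLeftCLM ℂ (fun y => ((latticeBump (meshCoord n 4 h hh) β y : ℝ) : ℂ)) G ∈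
      closure (Submodule.span ℂ {P : SchwartzMap (Fin n → E4) ℂ |
        ∃ f : Fin n → SchwartzMap E4 ℝ, IsTensorOf P (fun i => ofRealTest (f i)) ∧
          ∃ r R : ℝ, 0 < r ∧ (∀ i, tsupport (f i : E4 → ℝ) ⊆ Metric.closedBall (0 : E4) R) ∧
            ∀ i j, i ≠ j → ∀ y ∈ tsupport (f i : E4 → ℝ), ∀ z ∈ tsupport (f j : E4 → ℝ),
              r ≤ ‖y - z‖} : Set (SchwartzMap (Fin n → E4) ℂ)) := by
  -- adapted from `LocalOffDiagDensity.smulLeftCLM_latticeBump_mem_closure` (crux `NPointIsotropy`)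
  set Gβ := SchwartzMap.smulLeftCLM ℂ (fun y => ((latticeBump (meshCoord n 4 h hh) β y : ℝ) : ℂ)) G
    with hGβ
  -- the box of `β` in the coordinates `v_i^c`
  obtain ⟨b, hb⟩ : ∃ b : Fin n × Fin 4 → ℝ, ∀ ic, b ic = ((β (finProdFinEquiv ic) : ℤ) : ℝ) :=
    ⟨_, fun _ => rfl⟩
  have hbox : ∀ v ∈ tsupport (Gβ : (Fin n → E4) → ℂ), ∀ ic : Fin n × Fin 4,
      b ic * h - h ≤ v ic.1 ic.2 ∧ v ic.1 ic.2 ≤ b ic * h + h := by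
    intro v hv ic
    have h1 := (SchwartzMap.tsupport_smulLeftCLM_subset (F := ℂ) _ G hv).2
    rw [tsupport_latticeBumpC (meshCoord n 4 h hh) β] at h1
    have h2 := tsupport_latticeBump_subset (meshCoord n 4 h hh) β h1 (finProdFinEquiv ic)
    rw [meshCoord_apply, mem_Icc, ← hb ic] at h2
    constructor
    · have h3 : b ic - 1 ≤ v ic.1 ic.2 / h := by linarith [h2.1]
      rw [le_div_iff₀ hh] at h3
      linarith
    · have h3 : v ic.1 ic.2 / h ≤ b ic + 1 := by linarith [h2.2]
      rw [div_le_iff₀ hh] at h3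
      linarith
  -- the zero piece
  by_cases hG0 : Gβ = 0
  · rw [hG0]
    exact subset_closure (Submodule.zero_mem _)
  -- otherwise a point of `tsupport G` lies in the box
  obtain ⟨v, hv⟩ : ∃ v, Gβ v ≠ 0 := by
    by_contra hcon
    push Not at hcon
    exact hG0 (SchwartzMap.ext hcon)
  have hvbox := hbox v (subset_tsupport _ hv)
  have hGv : G v ≠ 0 := by
    rw [hGβ, SchwartzMap.smulLeftCLM_apply_apply
      (hasTemperateGrowth_latticeBumpC (meshCoord n 4 h hh) β)] at hv
    exact right_ne_zero_of_smul hv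
  have hvsep := hsep v (subset_tsupport _ hGv)
  -- the nested boxes and the box engine
  let B : BoxData n 4 :=
    { l := fun ic => b ic * h - 2 * h, u := fun ic => b ic * h + 2 * h
      l' := fun ic => b ic * h - h, u' := fun ic => b ic * h + h
      hl := fun ic => by linarith, hl' := fun ic => by linarith, hu := fun ic => by linarith }
  let Λ₀ : E4 ≃L[ℝ] E4 := ContinuousLinearEquiv.refl ℝ _
  have hF' : tsupport (Gβ : (Fin n → E4) → ℂ) ⊆
      {v | ∀ ic : Fin n × Fin 4, (Λ₀ (v ic.1)) ic.2 ∈ Icc (B.l' ic) (B.u' ic)} :=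
    fun v hv ic => hbox v hv ic
  refine closure_mono (Submodule.span_mono ?_) (mem_closure_span_boxTensors Λ₀ B Gβ hF')
  rintro P ⟨g, hg, hP⟩
  -- the factors `g k` are supported in the outer blocks
  have hblk : ∀ (k : Fin n) (x : E4), x ∈ tsupport (g k : E4 → ℝ) → ∀ c : Fin 4,
      b (k, c) * h - 2 * h < x c ∧ x c < b (k, c) * h + 2 * h := fun k x hx c => hg k hx c
  -- a common bound for the outer blocks
  set M : ℝ := (∑ ic, |b ic|) * h + 2 * h with hM
  have hMb : ∀ ic, |b ic| * h + 2 * h ≤ M := fun ic => by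
    have h1 : |b ic| ≤ ∑ ic, |b ic| :=
      Finset.single_le_sum (f := fun ic => |b ic|) (fun _ _ => abs_nonneg _) (Finset.mem_univ ic)
    have h2 := mul_le_mul_of_nonneg_right h1 hh.le
    linarith
  have hM0 : 0 ≤ M := by positivity
  have hsqrt : Real.sqrt (Fintype.card (Fin 4) : ℕ) = 2 := by
    rw [Fintype.card_fin, Nat.cast_ofNat, show (4 : ℝ) = 2 ^ 2 by norm_num,
      Real.sqrt_sq (by norm_num)]
  refine ⟨g, hP, 6 * h, 2 * M, by positivity, fun k x hx => ?_, fun i j hij y hy z hz => ?_⟩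
  · -- bounded supports
    rw [Metric.mem_closedBall, dist_zero_right]
    have hcoord : ∀ c : Fin 4, |x c| ≤ M := by
      intro c
      have h1 := hblk k x hx c
      have h2 : b (k, c) * h ≤ |b (k, c)| * h :=
        mul_le_mul_of_nonneg_right (le_abs_self _) hh.le
      have h3 : -|b (k, c)| * h ≤ b (k, c) * h :=
        mul_le_mul_of_nonneg_right (neg_abs_le _) hh.le
      have h4 := hMb (k, c)
      rw [abs_le]
      constructor <;> linarith [h1.1, h1.2]
    have hnorm := EuclideanSpace.norm_le_sqrt_card_mul x hM0 hcoord
    rw [hsqrt] at hnorm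
    exact hnorm
  · -- separated supports: else `‖v_i - v_j‖ ≤ 24 h`
    by_contra hlt
    push Not at hlt
    have hyz : ∀ c : Fin 4, |y c - z c| < 6 * h := fun c => by
      rw [← PiLp.sub_apply, ← Real.norm_eq_abs]
      exact (PiLp.norm_apply_le (y - z) c).trans_lt hlt
    have hcoord : ∀ c : Fin 4, |(v i - v j) c| ≤ 12 * h := by
      intro c
      rw [PiLp.sub_apply, abs_le]
      have h1 := hblk i y hy c
      have h2 := hblk j z hz c
      have h3 := hvbox (i, c)
      have h4 := hvbox (j, c)
      have h5 := abs_lt.1 (hyz c)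
      dsimp only at h3 h4
      constructor <;> linarith [h1.1, h1.2, h2.1, h2.2, h3.1, h3.2, h4.1, h4.2, h5.1, h5.2]
    have hnorm := EuclideanSpace.norm_le_sqrt_card_mul (v i - v j) (by positivity) hcoord
    rw [hsqrt] at hnorm
    linarith [hvsep i j hij]

/-- **Compactly supported test functions off the diagonals are limits of separated compactly
supported real product tensors** (the local part). If `G ∈ 𝓢((ℝ⁴)ⁿ, ℂ)` has compact support
contained in the complement of the coincidence locus, then `G` belongs to the closure of the
`ℂ`-span of the separated compactly supported real product tensors.  Proof: a mesh `h₀` with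
`12 h₀ < ‖vᵢ - vⱼ‖` on `tsupport G` (`LocalOffDiagDensity.exists_mesh`), halved to `h = h₀ / 2`; the
lattice partition of unity at mesh `h`, `W_R · G → G` (`tendsto_latticeWindow_smul`) with
`W_R · G = ∑_β η_β · G`; every piece is in the closed span
(`SepDensity.smulLeftCLM_latticeBump_mem_closure`), and the closure of a submodule is a submodule.
[folklore] -/
theorem mem_closure_of_hasCompactSupport (n : ℕ) (G : SchwartzMap (Fin n → E4) ℂ)
    (hG : HasCompactSupport (G : (Fin n → E4) → ℂ))
    (hGA : tsupport (G : (Fin n → E4) → ℂ) ⊆ (coincidenceLocus n E4)ᶜ) :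
    G ∈ closure (Submodule.span ℂ {P : SchwartzMap (Fin n → E4) ℂ |
        ∃ f : Fin n → SchwartzMap E4 ℝ, IsTensorOf P (fun i => ofRealTest (f i)) ∧
          ∃ r R : ℝ, 0 < r ∧ (∀ i, tsupport (f i : E4 → ℝ) ⊆ Metric.closedBall (0 : E4) R) ∧
            ∀ i j, i ≠ j → ∀ y ∈ tsupport (f i : E4 → ℝ), ∀ z ∈ tsupport (f j : E4 → ℝ),
              r ≤ ‖y - z‖} : Set (SchwartzMap (Fin n → E4) ℂ)) := by
  -- adapted from `localOffDiagDensity` (crux `NPointIsotropy`)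
  set S : Set 𝓢((Fin n → E4), ℂ) := {P : SchwartzMap (Fin n → E4) ℂ |
    ∃ f : Fin n → SchwartzMap E4 ℝ, IsTensorOf P (fun i => ofRealTest (f i)) ∧
      ∃ r R : ℝ, 0 < r ∧ (∀ i, tsupport (f i : E4 → ℝ) ⊆ Metric.closedBall (0 : E4) R) ∧
        ∀ i j, i ≠ j → ∀ y ∈ tsupport (f i : E4 → ℝ), ∀ z ∈ tsupport (f j : E4 → ℝ),
          r ≤ ‖y - z‖}
  have hC : IsClosed (closure (Submodule.span ℂ S : Set 𝓢((Fin n → E4), ℂ))) := isClosed_closure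
  -- step 1: a mesh below HALF the separation of the components on the compact `tsupport G`
  obtain ⟨h₀, hh₀, hsep₀⟩ := LocalOffDiagDensity.exists_mesh hG.isCompact hGA
  have hh : 0 < h₀ / 2 := half_pos hh₀
  have hsep : ∀ v ∈ tsupport (G : (Fin n → E4) → ℂ), ∀ i j : Fin n, i ≠ j →
      24 * (h₀ / 2) < ‖v i - v j‖ := by
    intro v hv i j hij
    have h1 := hsep₀ v hv i j hij
    linarith
  -- step 2: the lattice partition of unity at mesh `h₀ / 2`, `W_R · G → G`
  set Λ := meshCoord n 4 (h₀ / 2) hh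
  have hlim : Tendsto (fun R : ℕ => ∑ β ∈ latticeCube (n * 4) R,
      SchwartzMap.smulLeftCLM ℂ (fun y => ((latticeBump Λ β y : ℝ) : ℂ)) G) atTop (𝓝 G) := by
    have hsum : ∀ R : ℕ, ∑ β ∈ latticeCube (n * 4) R,
        SchwartzMap.smulLeftCLM ℂ (fun y => ((latticeBump Λ β y : ℝ) : ℂ)) G =
          SchwartzMap.smulLeftCLM ℂ (fun y => ((latticeWindow Λ R y : ℝ) : ℂ)) G := by
      intro R
      have hW : (fun y => ((latticeWindow Λ R y : ℝ) : ℂ)) =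
          fun y => ∑ β ∈ latticeCube (n * 4) R, ((latticeBump Λ β y : ℝ) : ℂ) := by
        funext y
        rw [← sum_latticeCube_latticeBump Λ R y, Complex.ofReal_sum]
      rw [hW, SchwartzMap.smulLeftCLM_sum fun β _ => hasTemperateGrowth_latticeBumpC Λ β,
        FunLike.coe_sum, Finset.sum_apply]
    simp_rw [hsum]
    exact tendsto_latticeWindow_smul Λ ℂ G
  refine hC.mem_of_tendsto hlim (Eventually.of_forall fun R => ?_)
  -- step 3: every piece lies in the closed span
  exact (Submodule.span ℂ S).topologicalClosure.sum_mem fun β _ =>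
    smulLeftCLM_latticeBump_mem_closure G hh hsep β

end SepDensity

/-- **Stub A1 — separated density.**  Every `F ∈ ⁰𝒮((ℝ⁴)ⁿ)` lies in the closure of the `ℂ`-span of
the real product tensors `P = ⊗ᵢ fᵢ` whose factors are compactly supported (`tsupport fᵢ ⊆ B̄(0,R)`)
with PAIRWISE SEPARATED supports (`r ≤ ‖y − z‖` for `y ∈ tsupport fᵢ`, `z ∈ tsupport fⱼ`, `i ≠ j`,
some `r > 0`).  Sharpening of the landed `offDiagDensity`: the cut-off family `offDiagCutoffFamily`
and `offDiagCutoffTendsto` give `ψ_k F → F` with `ψ_k F` vanishing near the diagonals; the inner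
compact cut-offs (`mem_of_isClosed_of_cutoffs`) reduce to compactly supported `G` with `tsupport G`
off the coincidence locus (`tsupport_cutoff_mul_subset_compl_coincidenceLocus`), which are handled by
the lattice partition at half the separation mesh (`SepDensity.mem_closure_of_hasCompactSupport`).
[folklore] -/
theorem stub_sepDensity :
    ∀ (n : ℕ) (F : SchwartzMap (Fin n → E4) ℂ), IsOffDiagonal F →
      F ∈ closure (Submodule.span ℂ {P : SchwartzMap (Fin n → E4) ℂ |
        ∃ f : Fin n → SchwartzMap E4 ℝ, IsTensorOf P (fun i => ofRealTest (f i)) ∧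
          ∃ r R : ℝ, 0 < r ∧ (∀ i, tsupport (f i : E4 → ℝ) ⊆ Metric.closedBall (0 : E4) R) ∧
            ∀ i j, i ≠ j → ∀ y ∈ tsupport (f i : E4 → ℝ), ∀ z ∈ tsupport (f j : E4 → ℝ),
              r ≤ ‖y - z‖} : Set (SchwartzMap (Fin n → E4) ℂ)) := by
  -- adapted from `offDiagDensity` (crux `NPointIsotropy`)
  intro n F hF
  obtain ⟨C, ψ, hsmooth, h01, hone, hzero, hbound⟩ := offDiagCutoffFamily n
  obtain ⟨u, hu, hlim⟩ := offDiagCutoffTendsto n C ψ hsmooth h01 hone hbound F hF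
  refine isClosed_closure.mem_of_tendsto hlim (Eventually.of_forall fun k => ?_)
  refine mem_of_isClosed_of_cutoffs isClosed_closure (u k) fun v hvc hvs =>
    SepDensity.mem_closure_of_hasCompactSupport n v hvc ?_
  exact hvs.trans (tsupport_cutoff_mul_subset_compl_coincidenceLocus k (hzero k) (hu k))

end Summit.QuantumFields.YangMills.Theorems.TemperedCurvatureMoments.Sketch

end
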